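import Summits.SmoothPoincare4.SmoothPoincare4.Theorems.EntropyRungBakryEmeryLogSobolevEntropyCutoff
import Summits.SmoothPoincare4.SmoothPoincare4.Theorems.EntropyRungBakryEmeryLogSobolevFisherDecay
import HarnessLib

/-!
# Integrated entropy production along the weighted heat flow on a complete `CD(K,∞)` manifold
# (support item `EntropyRung.BakryEmeryLogSobolev`, stmt-SmoothPoincare4-16587)

Setting: `M` modelled on `ℝⁿ` (Hausdorff, second countable, `T₃`, Borel — NOT compact), `g` Riemannian with
its Levi-Civita connection, `V` smooth with `e^{-V} ∈ L¹` and `Ric_g + Hess V ≥ K g`, `K > 0`,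
`L = Δ_g − g⁻¹(dV, d·)`, Gaffney cut-offs `η_k` (`0 ≤ η_k ≤ 1`, `η_k → 1`, `|∇η_k|² ≤ C₀/(k+1)²`).

`gaffney_entropyProduction` — for `u` smooth on `M × O` (`O ⊇ [0, T]` open), `∂ₛu = Lu`, `0 < a ≤ u ≤ b` and
`|∇u|² ≤ C_G` on `[0, T]`:
`∫ u(0) log u(0) e^{-V} − ∫ u(T) log u(T) e^{-V} ≤ (1/2K) ∫ |∇u(0)|²/u(0) e^{-V}`.
Proof: the cut-off de Bruijn identity `|d/dt ∫ η_k² u log u e^{-V} + ∫ η_k² |∇u|²/u e^{-V}| ≤ ε_k`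
(`entropyCutoffSq_le`, `ε_k = 2(1+Λ) √C₀/(k+1) √C_G ∫e^{-V}`), the Fisher decay
`∫ |∇u(t)|²/u(t) e^{-V} ≤ e^{-2Kt} ∫ |∇u(0)|²/u(0) e^{-V}` (`gaffney_fisherDecay`), monotonicity of
`t ↦ ∫ η_k² u log u e^{-V} − (J₀/2K) e^{-2Kt} + ε_k t` on `[0, T]`, and `k → ∞` by dominated convergence.
Everything is proved; no definitions.

## References

* [BakryGentilLedoux2014] D. Bakry, I. Gentil, M. Ledoux (2014), Thm. 5.2.1 / Prop. 5.7.1 and §5.7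
  (pp. 236–240, 268–270), with §3.2 (pp. 141–147) for the cut-offs.
* [BakryEmery1985] D. Bakry, M. Émery, *Diffusions hypercontractives* (1985).
-/

noncomputable section

set_option linter.dupNamespace false

open scoped Manifold ContDiff ENNReal NNReal Topology
open MeasureTheory Set Filter
open Literature.Geometry.Lorentzian Literature.Geometry.Riemannian

namespace Summit.SmoothPoincare4.SmoothPoincare4.Theorems.BakryEmeryComplete

open NoncompactShrinkerGapHeat NoncompactShrinkerGapHeat.CutoffToolkit

section EntropyProduction

variable {n : ℕ} {M : Type*} [TopologicalSpace M] [T2Space M] [SecondCountableTopology M]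
  [ChartedSpace (EuclideanSpace ℝ (Fin n)) M] [IsManifold (𝓡 n) ∞ M] [T3Space M]
  [MeasurableSpace M] [BorelSpace M]
  {g : PseudoRiemannianMetric (𝓡 n) ∞ (EuclideanSpace ℝ (Fin n)) (TangentSpace (𝓡 n) : M → Type _)}
  [g.HasLeviCivita]

/-- **Integrated entropy production along the weighted heat flow on a complete `CD(K,∞)` manifold,
`K > 0`** (see the module docstring): for `u` smooth on `M × O`, `∂ₛu = Lu` on `[0,T]`, `0 < a ≤ u ≤ b`,
`|∇u|² ≤ C_G` on `[0,T] × M`, `e^{-V} ∈ L¹`, and Gaffney cut-offs,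
`∫ u(0) log u(0) e^{-V} − ∫ u(T) log u(T) e^{-V} ≤ (1/2K) ∫ |∇u(0)|²/u(0) e^{-V}`.
[cite: BakryGentilLedoux2014, Thm. 5.2.1, Prop. 5.7.1 (pp. 236–240, 268)] [cite: BakryEmery1985] -/
theorem gaffney_entropyProduction (hg : g.IsRiemannian) {V : M → ℝ} {K : ℝ}
    (hV : ContMDiff (𝓡 n) 𝓘(ℝ, ℝ) ∞ V)
    (hRic : ∀ (y : M) (X : TangentSpace (𝓡 n) y), K * g.val y X X ≤ g.ricci y X X + g.hessian V y X X)
    (hK : 0 < K) (hw : Integrable (fun y ↦ Real.exp (-V y)) g.riemVolume)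
    {η : ℕ → M → ℝ} {C₀ : ℝ} (hηs : ∀ k, ContMDiff (𝓡 n) 𝓘(ℝ, ℝ) ∞ (η k))
    (hηc : ∀ k, HasCompactSupport (η k)) (hη01 : ∀ k x, 0 ≤ η k x ∧ η k x ≤ 1)
    (hη1 : ∀ x, ∀ᶠ k in atTop, η k x = 1)
    (hηgrad : ∀ k x, g.gradSq (η k) x ≤ C₀ / ((k : ℝ) + 1) ^ 2)
    {T : ℝ} {O : Set ℝ} {u : ℝ → M → ℝ} (hT : 0 < T) (hO : IsOpen O) (hTO : Icc 0 T ⊆ O)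
    (hu : ContMDiffOn ((𝓡 n).prod 𝓘(ℝ, ℝ)) 𝓘(ℝ, ℝ) ∞ (fun p : M × ℝ ↦ u p.2 p.1) (univ ×ˢ O))
    (heq : ∀ s ∈ Icc 0 T, ∀ x, deriv (fun r ↦ u r x) s = g.dalembertian (u s) x
      - g.innerDual x (mvfderiv (𝓡 n) V x).toLinearMap (mvfderiv (𝓡 n) (u s) x).toLinearMap)
    {a b CG : ℝ} (ha : 0 < a) (hab : ∀ s ∈ Icc 0 T, ∀ x, a ≤ u s x ∧ u s x ≤ b)
    (hG : ∀ s ∈ Icc 0 T, ∀ x, g.gradSq (u s) x ≤ CG) :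
    (∫ y, u 0 y * Real.log (u 0 y) * Real.exp (-V y) ∂g.riemVolume)
      - ∫ y, u T y * Real.log (u T y) * Real.exp (-V y) ∂g.riemVolume ≤
      1 / (2 * K) * ∫ y, g.gradSq (u 0) y / u 0 y * Real.exp (-V y) ∂g.riemVolume := by
  haveI := CarrilloNi2009_shrinkerLSI.isFiniteMeasureOnCompacts_riemVolume hg
  set μ : Measure M := g.riemVolume with hμ
  -- the time set `S = [0, T]`
  set S : Set ℝ := Icc 0 T with hSdef
  have hS : UniqueDiffOn ℝ S := uniqueDiffOn_Icc hT
  have h0S : (0 : ℝ) ∈ S := ⟨le_rfl, hT.le⟩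
  have hTS : T ∈ S := ⟨hT.le, le_rfl⟩
  have huS : ContMDiffOn ((𝓡 n).prod 𝓘(ℝ, ℝ)) 𝓘(ℝ, ℝ) ∞ (fun p : M × ℝ ↦ u p.2 p.1) (univ ×ˢ S) :=
    hu.mono (prod_mono le_rfl hTO)
  have hpos : ∀ t ∈ S, ∀ y, 0 < u t y := fun t ht y ↦ ha.trans_le (hab t ht y).1
  have hslice : ∀ t ∈ S, ContMDiff (𝓡 n) 𝓘(ℝ, ℝ) ∞ (u t) := fun t ht ↦
    huS.comp_contMDiff (contMDiff_id.prodMk contMDiff_const) fun y ↦ ⟨mem_univ _, ht⟩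
  -- the equation within `S`
  have hdS : ∀ t ∈ S, ∀ y, HasDerivAt (fun r ↦ u r y) (deriv (fun r ↦ u r y) t) t := fun t ht y ↦
    hasDerivAt_slice_of_contMDiffOn hO (v := fun p : M × ℝ ↦ u p.2 p.1) hu y (hTO ht)
  have heqS : ∀ t ∈ S, ∀ y, derivWithin (fun r ↦ u r y) S t = g.dalembertian (u t) y
      - g.innerDual y (mvfderiv (𝓡 n) V y).toLinearMap (mvfderiv (𝓡 n) (u t) y).toLinearMap := by
    intro t ht y
    rw [(hdS t ht y).differentiableAt.derivWithin (hS t ht)]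
    exact heq t ht y
  -- the entropy integrand `E(t, y) = u log u e^{-V}`, jointly smooth on `M × S`
  have hEfam : ContMDiffOn ((𝓡 n).prod 𝓘(ℝ, ℝ)) 𝓘(ℝ, ℝ) ∞ (fun p : M × ℝ ↦
      u p.2 p.1 * Real.log (u p.2 p.1) * Real.exp (-V p.1)) (univ ×ˢ S) := by
    have hlog : ContMDiffOn ((𝓡 n).prod 𝓘(ℝ, ℝ)) 𝓘(ℝ, ℝ) ∞ (fun p : M × ℝ ↦ Real.log (u p.2 p.1))
        (univ ×ˢ S) := by
      intro p hp
      have hne : u p.2 p.1 ≠ 0 := (hpos p.2 hp.2 p.1).ne'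
      exact (Real.contDiffAt_log.2 hne).comp_contMDiffWithinAt (f := fun p : M × ℝ ↦ u p.2 p.1) (x := p)
        (huS p hp)
    have hwf : ContMDiffOn ((𝓡 n).prod 𝓘(ℝ, ℝ)) 𝓘(ℝ, ℝ) ∞ (fun p : M × ℝ ↦ Real.exp (-V p.1)) (univ ×ˢ S) :=
      ((Real.contDiff_exp.comp contDiff_neg).comp_contMDiff (hV.comp contMDiff_fst)).contMDiffOn
    exact (huS.mul hlog).mul hwf
  have hE'fam := contMDiffOn_derivWithin_time_of_uniqueDiffOn (u := fun t y ↦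
      u t y * Real.log (u t y) * Real.exp (-V y)) hS hEfam
  -- constants and pointwise bounds
  have hC₀ : ∀ y : M, 0 ≤ C₀ := fun y ↦ by
    have h1 := hηgrad 0 y
    have h2 : 0 ≤ g.gradSq (η 0) y := g.gradSq_nonneg hg _ _
    rcases div_nonneg_iff.1 (h2.trans h1) with h | h
    · exact h.1
    · exact absurd h.2 (not_le.mpr (by positivity))
  set Λ : ℝ := max |Real.log a| |Real.log b| with hΛ
  have hlogbd : ∀ t ∈ S, ∀ y, |Real.log (u t y)| ≤ Λ := by
    intro t ht y
    have h1 : Real.log a ≤ Real.log (u t y) := Real.log_le_log ha (hab t ht y).1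
    have h2 : Real.log (u t y) ≤ Real.log b := Real.log_le_log (hpos t ht y) (hab t ht y).2
    refine abs_le.2 ⟨?_, ?_⟩
    · have := neg_abs_le (Real.log a)
      linarith [le_max_left |Real.log a| |Real.log b|]
    · linarith [le_abs_self (Real.log b), le_max_right |Real.log a| |Real.log b|]
  have hEbd : ∀ t ∈ S, ∀ y, |u t y * Real.log (u t y) * Real.exp (-V y)| ≤ b * Λ * Real.exp (-V y) := by
    intro t ht y
    have hb0 : 0 ≤ b := ha.le.trans ((hab t ht y).1.trans (hab t ht y).2)
    rw [abs_mul, abs_mul, abs_of_nonneg (Real.exp_pos _).le, abs_of_nonneg (hpos t ht y).le]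
    exact mul_le_mul_of_nonneg_right (mul_le_mul (hab t ht y).2 (hlogbd t ht y) (abs_nonneg _) hb0)
      (Real.exp_pos _).le
  -- the Fisher informations `J t`, nonnegative, bounded by the decay estimate
  have hWc : Continuous fun y ↦ Real.exp (-V y) := Real.continuous_exp.comp hV.continuous.neg
  have hQc : ∀ t ∈ S, Continuous fun y ↦ g.gradSq (u t) y / u t y := fun t ht ↦
    (contMDiff_gradSq g (hslice t ht)).continuous.div (hslice t ht).continuous fun y ↦ (hpos t ht y).ne'
  have hQbd : ∀ t ∈ S, ∀ y, 0 ≤ g.gradSq (u t) y / u t y ∧ g.gradSq (u t) y / u t y ≤ CG / a := by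
    intro t ht y
    have hQ0 : 0 ≤ g.gradSq (u t) y := g.gradSq_nonneg hg _ _
    have hρpos := hpos t ht y
    refine ⟨div_nonneg hQ0 hρpos.le, ?_⟩
    rw [div_le_div_iff₀ hρpos ha]
    nlinarith [hG t ht y, (hab t ht y).1]
  have hQint : ∀ t ∈ S, Integrable (fun y ↦ g.gradSq (u t) y / u t y * Real.exp (-V y)) μ := by
    intro t ht
    refine (hw.const_mul (CG / a)).mono' ((hQc t ht).mul hWc).aestronglyMeasurable
      (Eventually.of_forall fun y ↦ ?_)
    rw [Real.norm_eq_abs, abs_of_nonneg (mul_nonneg (hQbd t ht y).1 (Real.exp_pos _).le)]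
    exact mul_le_mul_of_nonneg_right (hQbd t ht y).2 (Real.exp_pos _).le
  set J : ℝ → ℝ := fun t ↦ ∫ y, g.gradSq (u t) y / u t y * Real.exp (-V y) ∂μ with hJdef
  have hJ0 : ∀ t ∈ S, 0 ≤ J t := fun t ht ↦ integral_nonneg fun y ↦ mul_nonneg (hQbd t ht y).1 (Real.exp_pos _).le
  have hJdecay : ∀ t ∈ S, J t ≤ Real.exp (-2 * K * t) * J 0 := fun t ht ↦
    gaffney_fisherDecay hg hV hRic hw hηs hηc hη01 hη1 hηgrad hT hO hTO hu heq ha hab hG t ht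
  -- the entropies `H t`
  have hEc : ∀ t ∈ S, Continuous fun y ↦ u t y * Real.log (u t y) * Real.exp (-V y) := fun t ht ↦
    (hEfam.continuousOn.comp_continuous (continuous_id.prodMk continuous_const) fun y ↦ ⟨mem_univ _, ht⟩ :)
  set H : ℝ → ℝ := fun t ↦ ∫ y, u t y * Real.log (u t y) * Real.exp (-V y) ∂μ with hHdef
  -- the cut-off entropies `B k`, their derivatives `DB k`, the cut-off Fisher informations `A k`, errors `ε k`
  set B : ℕ → ℝ → ℝ := fun k t ↦ ∫ y, η k y ^ 2 * (u t y * Real.log (u t y) * Real.exp (-V y)) ∂μ with hBdef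
  set DB : ℕ → ℝ → ℝ := fun k t ↦ ∫ y, η k y ^ 2 * derivWithin (fun s ↦ u s y * Real.log (u s y) *
      Real.exp (-V y)) S t ∂μ with hDBdef
  set A : ℕ → ℝ → ℝ := fun k t ↦ ∫ y, η k y ^ 2 * (g.gradSq (u t) y / u t y * Real.exp (-V y)) ∂μ with hAdef
  set δ : ℕ → ℝ := fun k ↦ Real.sqrt C₀ / ((k : ℝ) + 1) with hδdef
  have hδ0 : ∀ k, 0 ≤ δ k := fun k ↦ div_nonneg (Real.sqrt_nonneg _) (by positivity)
  have hδgrad : ∀ k y, g.gradSq (η k) y ≤ δ k ^ 2 := fun k y ↦ by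
    simp only [hδdef]
    rw [div_pow, Real.sq_sqrt (hC₀ y)]
    exact hηgrad k y
  set W₀ : ℝ := ∫ y, Real.exp (-V y) ∂μ with hW₀
  set ε : ℕ → ℝ := fun k ↦ 2 * (1 + Λ) * δ k * Real.sqrt CG * W₀ with hεdef
  have hηabs : ∀ k y, |η k y| ≤ 1 := fun k y ↦ abs_le.2 ⟨by linarith [(hη01 k y).1], (hη01 k y).2⟩
  have hsq1 : ∀ k y, η k y ^ 2 ≤ 1 := fun k y ↦ pow_le_one₀ (hη01 k y).1 (hη01 k y).2
  -- (e1) the cut-off de Bruijn inequality: `DB k t ≥ -A k t - ε k ≥ -e^{-2Kt} J 0 - ε k`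
  have hAle : ∀ k, ∀ t ∈ S, A k t ≤ J t := fun k t ht ↦ by
    refine integral_mono_of_nonneg (Eventually.of_forall fun y ↦ ?_) (hQint t ht)
      (Eventually.of_forall fun y ↦ ?_)
    · exact mul_nonneg (sq_nonneg _) (mul_nonneg (hQbd t ht y).1 (Real.exp_pos _).le)
    · exact mul_le_of_le_one_left (mul_nonneg (hQbd t ht y).1 (Real.exp_pos _).le) (hsq1 k y)
  have e1 : ∀ k, ∀ t ∈ S, -(Real.exp (-2 * K * t) * J 0) - ε k ≤ DB k t := by
    intro k t ht
    have h : |DB k t + A k t| ≤ ε k :=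
      entropyCutoffSq_le hg hV hw hS huS heqS (hηs k) (hηc k) (hηabs k) (hδ0 k) (hδgrad k) ht ha
        (hab t ht) (hG t ht)
    have h3 := (abs_le.1 h).1
    linarith [hAle k t ht, hJdecay t ht]
  -- (e2), (e3): continuity on `S`, differentiability on the interior, under the integral sign
  have hη2 : ∀ k, Continuous fun y ↦ η k y ^ 2 := fun k ↦ (hηs k).continuous.pow 2
  have hη2c : ∀ k, HasCompactSupport (fun y ↦ η k y ^ 2) := fun k ↦ by
    rw [show (fun y ↦ η k y ^ 2) = fun y ↦ η k y * η k y from funext fun y ↦ sq (η k y)]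
    exact (hηc k).mul_right
  have hswapE : ContinuousOn (Function.uncurry fun t y ↦ u t y * Real.log (u t y) * Real.exp (-V y))
      (S ×ˢ univ) := by
    have h1 := hEfam.continuousOn.comp continuous_swap.continuousOn
      (fun (q : ℝ × M) (hq : q ∈ S ×ˢ (univ : Set M)) ↦ show q.swap ∈ univ ×ˢ S from ⟨mem_univ _, hq.1⟩)
    exact h1.congr (by rintro ⟨t, y⟩ _; rfl)
  have hswapE' : ContinuousOn (Function.uncurry fun t y ↦ derivWithin (fun s ↦ u s y * Real.log (u s y) *
      Real.exp (-V y)) S t) (Ioo 0 T ×ˢ univ) := by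
    have h1 := hE'fam.continuousOn.comp continuous_swap.continuousOn
      (fun (q : ℝ × M) (hq : q ∈ Ioo 0 T ×ˢ (univ : Set M)) ↦
        show q.swap ∈ univ ×ˢ S from ⟨mem_univ _, Ioo_subset_Icc_self hq.1⟩)
    exact h1.congr (by rintro ⟨t, y⟩ _; rfl)
  have e2 : ∀ k, ContinuousOn (B k) S := fun k ↦ by
    have h := Literature.Analysis.FluidPDE.continuousOn_integral_smul_of_continuousOn (μ := μ)
      (hη2 k) (hη2c k) hswapE
    simp only [smul_eq_mul] at h
    exact h
  have e3 : ∀ k, ∀ t ∈ Ioo 0 T, HasDerivAt (B k) (DB k t) t := by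
    intro k t ht
    have hder : ∀ s ∈ Ioo 0 T, ∀ y, HasDerivAt (fun r ↦ u r y * Real.log (u r y) * Real.exp (-V y))
        (derivWithin (fun r ↦ u r y * Real.log (u r y) * Real.exp (-V y)) S s) s :=
      fun s hs y ↦ (hasDerivWithinAt_time_of_contMDiffOn (k := ∞) (u := fun t y ↦ u t y * Real.log (u t y) *
        Real.exp (-V y)) (by simp) hEfam y (Ioo_subset_Icc_self hs)).hasDerivAt (Icc_mem_nhds hs.1 hs.2)
    have h := Literature.Analysis.FluidPDE.hasDerivAt_integral_smul_of_continuousOn (μ := μ)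
      (hη2 k) (hη2c k) isOpen_Ioo (hswapE.mono (prod_mono Ioo_subset_Icc_self le_rfl)) hswapE' hder ht
    simp only [smul_eq_mul] at h
    exact h
  -- the exponential primitive
  have hexd : ∀ t, HasDerivAt (fun s ↦ Real.exp (-2 * K * s)) (Real.exp (-2 * K * t) * (-2 * K)) t := fun t ↦ by
    have h1 : HasDerivAt (fun s : ℝ ↦ -2 * K * s) (-2 * K) t := by simpa using (hasDerivAt_id t).const_mul (-2 * K)
    exact h1.exp
  -- (main) `B k 0 - B k T ≤ J 0 / (2K) + T ε k`
  have hmain : ∀ k, B k 0 - B k T ≤ J 0 / (2 * K) + T * ε k := by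
    intro k
    set Θ : ℝ → ℝ := fun s ↦ B k s - J 0 / (2 * K) * Real.exp (-2 * K * s) + ε k * s with hΘ
    have hcontΘ : ContinuousOn Θ S :=
      ((e2 k).sub (continuous_const.mul (Real.continuous_exp.comp (continuous_const.mul
        continuous_id))).continuousOn).add (continuous_const.mul continuous_id).continuousOn
    have hdiffΘ : ∀ s ∈ Ioo 0 T, HasDerivAt Θ (DB k s - J 0 / (2 * K) * (Real.exp (-2 * K * s) * (-2 * K))
        + ε k) s := fun s hs ↦ by
      have h2 : HasDerivAt (fun s' : ℝ ↦ ε k * s') (ε k) s := by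
        simpa using (hasDerivAt_id s).const_mul (ε k)
      exact ((e3 k s hs).sub ((hexd s).const_mul _)).add h2
    have hΘmono : MonotoneOn Θ S := by
      refine monotoneOn_of_deriv_nonneg (convex_Icc 0 T) hcontΘ (fun s hs ↦ ?_) (fun s hs ↦ ?_)
      · rw [interior_Icc] at hs
        exact (hdiffΘ s hs).differentiableAt.differentiableWithinAt
      · rw [interior_Icc] at hs
        have hsS : s ∈ S := Ioo_subset_Icc_self hs
        rw [(hdiffΘ s hs).deriv]
        have h1 := e1 k s hsS
        have hK' : J 0 / (2 * K) * (Real.exp (-2 * K * s) * (-2 * K)) = -(Real.exp (-2 * K * s) * J 0) := by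
          rw [show J 0 / (2 * K) * (Real.exp (-2 * K * s) * (-2 * K))
              = -(Real.exp (-2 * K * s) * J 0) * ((2 * K) / (2 * K)) by ring, div_self (by positivity), mul_one]
        rw [hK']
        linarith
    have hΘle : Θ 0 ≤ Θ T := hΘmono h0S hTS hT.le
    simp only [hΘ, mul_zero, Real.exp_zero, mul_one, add_zero] at hΘle
    have hpos' : 0 ≤ J 0 / (2 * K) * Real.exp (-2 * K * T) :=
      mul_nonneg (div_nonneg (hJ0 0 h0S) (by positivity)) (Real.exp_pos _).le
    nlinarith [hΘle, hpos']
  -- `k → ∞`: `B k t → H t` (dominated convergence) and `ε k → 0`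
  have hlimB : ∀ t ∈ S, Tendsto (fun k ↦ B k t) atTop (𝓝 (H t)) := by
    intro t ht
    refine tendsto_integral_of_dominated_convergence (fun y ↦ b * Λ * Real.exp (-V y))
      (fun k ↦ ((hη2 k).mul (hEc t ht)).aestronglyMeasurable)
      (hw.const_mul (b * Λ)) (fun k ↦ Eventually.of_forall fun y ↦ ?_) (Eventually.of_forall fun y ↦ ?_)
    · rw [Real.norm_eq_abs, abs_mul, abs_of_nonneg (sq_nonneg (η k y))]
      calc η k y ^ 2 * |u t y * Real.log (u t y) * Real.exp (-V y)|
          ≤ 1 * (b * Λ * Real.exp (-V y)) :=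
            mul_le_mul (hsq1 k y) (hEbd t ht y) (abs_nonneg _) zero_le_one
        _ = b * Λ * Real.exp (-V y) := one_mul _
    · have h := (tendsto_cutoff_of_eventually_eq hη1 y).pow 2
      simpa using h.mul_const (u t y * Real.log (u t y) * Real.exp (-V y))
  have hlimε : Tendsto ε atTop (𝓝 0) := by
    have h1 : Tendsto (fun k : ℕ ↦ (k : ℝ) + 1) atTop atTop :=
      tendsto_atTop_add_const_right _ 1 (tendsto_natCast_atTop_atTop (R := ℝ))
    have hδ : Tendsto δ atTop (𝓝 0) := tendsto_const_nhds.div_atTop h1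
    have h := ((hδ.const_mul (2 * (1 + Λ))).mul_const (Real.sqrt CG)).mul_const W₀
    simp only [mul_zero, zero_mul] at h
    exact h
  have hlimL : Tendsto (fun k ↦ B k 0 - B k T) atTop (𝓝 (H 0 - H T)) := (hlimB 0 h0S).sub (hlimB T hTS)
  have hlimR : Tendsto (fun k ↦ J 0 / (2 * K) + T * ε k) atTop (𝓝 (J 0 / (2 * K) + T * 0)) :=
    tendsto_const_nhds.add (hlimε.const_mul T)
  have hfin := le_of_tendsto_of_tendsto' hlimL hlimR hmain
  rw [mul_zero, add_zero] at hfin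
  calc H 0 - H T ≤ J 0 / (2 * K) := hfin
    _ = 1 / (2 * K) * J 0 := by ring

end EntropyProduction

end Summit.SmoothPoincare4.SmoothPoincare4.Theorems.BakryEmeryComplete

end
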